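import Literature.Analysis.FluidPDE.SteadyNavierStokesEnergy

/-!
# Negative knowledge for the crux `EnsembleCeiling` (stmt-AnomalousDissipation-14090), III:
# the atoms of the Foias–Prodi class are exactly the steady states

Crux `TaylorCertificates.EnsembleCeiling` (route `AnomalousDissipation/TaylorCertificates`, rank 4),
cdisprove seat `refuter-cdisprove-stmt-AnomalousDissipation-14090-0`. The crux quantifies over ALL
stationary statistical solutions of FMRT IV Def. 1.3 (`Torus.IsStationaryStatisticalSolution`). This
small-model fact pins down its Dirac members: `δ_u` (`u ∈ V`) is a stationary statistical solution of
`NS_ν(f)` if and ONLY if `u` is a steady weak solution (`dirac_isStationary_iff_isSteadyWeakSolution`).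
The "if" is the tree theorem `Torus.isStationaryStatisticalSolution_dirac_holds` (FMRT IV §1.2, remark
pp. 181–182); the "only if" (`isSteadyWeakSolution_of_dirac`) localises the Liouville equation (1.30):
for a test field `w` the cylindrical functional with the single coordinate `(·, w)` and profile
`φ(y) = (y₀ - (u, w)) χ(y)` (`χ` a smooth bump `≡ 1` near `(u, w)`) has `Φ'(u) = w`, so (1.30) at `δ_u`
reads `⟨F(u), w⟩ = 0`. Consequences for the crux: every kill by a Dirac mass IS a fat steady state and
nothing else (used by Parts I–II), and a ceiling at `f` is equivalent, on atoms, to a ν-uniform energy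
bound on all finite-enstrophy steady states of `NS_ν(f)` — the ceiling half of crux
`SteadyStatesLoudBounded`. Nothing here asserts a Theses statement.
-/

noncomputable section

open MeasureTheory
open scoped InnerProductSpace ENNReal Topology

namespace Summit.AnomalousDissipation.AnomalousDissipation.Theorems.EnsembleCeiling.Negative

open Literature.Analysis.FunctionSpaces Literature.Analysis.FluidPDE

/-- **Atoms are steady states** (converse of `isStationaryStatisticalSolution_dirac`): if the Dirac
mass at `u ∈ H` is a stationary statistical solution of `NS_ν(f)`, then `u` is a steady weak solution.
Proof: for a test field `w` take the cylindrical functional with the single coordinate `(·, w)` and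
profile `φ(y) = (y₀ - (u,w)) χ(y)`, `χ` a smooth bump equal to `1` near `(u,w)`; then `Φ'(u) = w` and
the Liouville equation at `δ_u` reads `⟨F(u), w⟩ = 0`. -/
theorem isSteadyWeakSolution_of_dirac {ν : ℝ} {f : (UnitAddTorus (Fin 3)) → (EuclideanSpace ℝ (Fin 3))}
    {u : (Torus.energySpace (Fin 3))}
    (hμ : Torus.IsStationaryStatisticalSolution ν f (Measure.dirac u)) :
    Torus.IsSteadyWeakSolution ν f u := by
  haveI : MeasurableSingletonClass (Torus.energySpace (Fin 3)) := OpensMeasurableSpace.toMeasurableSingletonClass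
  intro w hw hdw hzw
  set c : ℝ := Torus.pairing ((u : (Torus.energySpace (Fin 3))) : (Lp (EuclideanSpace ℝ (Fin 3)) 2 (volume : Measure (UnitAddTorus (Fin 3))))) w with hc
  set y₀ : EuclideanSpace ℝ (Fin 1) := WithLp.toLp 2 (fun _ => c) with hy₀
  let χ : ContDiffBump y₀ := default
  set a : EuclideanSpace ℝ (Fin 1) → ℝ := fun y => EuclideanSpace.proj (𝕜 := ℝ) (0 : Fin 1) y - c with ha
  have ha_diff : ContDiff ℝ 1 a := ((EuclideanSpace.proj (𝕜 := ℝ) (0 : Fin 1)).contDiff).sub contDiff_const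
  have hχ_diff : ContDiff ℝ 1 (χ : EuclideanSpace ℝ (Fin 1) → ℝ) := χ.contDiff
  let Φ : Torus.CylindricalTest (Fin 3) :=
    { m := 1
      g := fun _ => w
      g_smooth := fun _ => hw
      g_divFree := fun _ => hdw
      g_zeroMean := fun _ => hzw
      φ := fun y => a y * χ y
      φ_contDiff := ha_diff.mul hχ_diff
      φ_compact := χ.hasCompactSupport.mul_left }
  have hcoords : Φ.coords u = y₀ := rfl
  have ha0 : a y₀ = 0 := by
    simp [ha, hy₀]
  have hχ1 : (χ : EuclideanSpace ℝ (Fin 1) → ℝ) y₀ = 1 := χ.one_of_mem_closedBall (Metric.mem_closedBall_self χ.rIn_pos.le)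
  have hderiv : _root_.fderiv ℝ Φ.φ (Φ.coords u) (EuclideanSpace.single (0 : Fin 1) (1 : ℝ)) = 1 := by
    rw [hcoords]
    change _root_.fderiv ℝ (fun y => a y * χ y) y₀ (EuclideanSpace.single (0 : Fin 1) (1 : ℝ)) = 1
    have hfun : (fun y => a y * (χ : EuclideanSpace ℝ (Fin 1) → ℝ) y) = a * (χ : EuclideanSpace ℝ (Fin 1) → ℝ) := rfl
    rw [hfun, fderiv_mul (ha_diff.differentiable one_ne_zero y₀) (hχ_diff.differentiable one_ne_zero y₀), ha0, hχ1,
      zero_smul, zero_add, one_smul]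
    rw [ha, fderiv_sub_const, ContinuousLinearMap.fderiv]
    simp
  have hgrad : Φ.grad u = w := by
    funext x
    change ∑ i : Fin 1, (_root_.fderiv ℝ Φ.φ (Φ.coords u) (EuclideanSpace.single i 1)) • Φ.g i x = w x
    rw [Fin.sum_univ_one, hderiv, one_smul]
  have h := (hμ.generator Φ).2
  rw [integral_dirac, hgrad] at h
  exact h

/-- **The Dirac members of the Foias–Prodi class are exactly the finite-enstrophy steady states**:
for `0 ≤ ν`, `f ∈ L²` and `u ∈ V`, `δ_u` is a stationary statistical solution of `NS_ν(f)` iff `u` is a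
steady weak solution. -/
theorem dirac_isStationary_iff_isSteadyWeakSolution {ν : ℝ} (hν : 0 ≤ ν)
    {f : (UnitAddTorus (Fin 3)) → (EuclideanSpace ℝ (Fin 3))} (hf : MemLp f 2 volume)
    {u : (Torus.energySpace (Fin 3))}
    (hV : ((u : (Torus.energySpace (Fin 3))) : (Lp (EuclideanSpace ℝ (Fin 3)) 2 (volume : Measure (UnitAddTorus (Fin 3))))) ∈ Torus.energySpaceV (Fin 3)) :
    Torus.IsStationaryStatisticalSolution ν f (Measure.dirac u) ↔ Torus.IsSteadyWeakSolution ν f u :=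
  ⟨isSteadyWeakSolution_of_dirac, fun hu => Torus.isStationaryStatisticalSolution_dirac_holds hν hf (by simp) hV hu⟩

/-- **A ceiling bounds all steady states** (the atoms' reading of the crux): if every stationary
statistical solution of `NS_ν(f)` with integrable energy has mean energy `≤ E`, then every steady weak
solution `u ∈ V` of `NS_ν(f)` has `‖u‖² ≤ E`. Contrapositive: fat steady states kill the ceiling. -/
theorem norm_sq_le_of_ceiling {ν : ℝ} (hν : 0 < ν)
    {f : (UnitAddTorus (Fin 3)) → (EuclideanSpace ℝ (Fin 3))} (hf : MemLp f 2 volume) {E : ℝ}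
    (h : ∀ μ : Measure (Torus.energySpace (Fin 3)), Torus.IsStationaryStatisticalSolution ν f μ →
      Integrable (fun v : (Torus.energySpace (Fin 3)) => ‖v‖ ^ 2) μ → Torus.ensembleEnergy μ ≤ E)
    {u : (Torus.energySpace (Fin 3))}
    (hV : ((u : (Torus.energySpace (Fin 3))) : (Lp (EuclideanSpace ℝ (Fin 3)) 2 (volume : Measure (UnitAddTorus (Fin 3))))) ∈ Torus.energySpaceV (Fin 3))
    (hu : Torus.IsSteadyWeakSolution ν f u) : ‖u‖ ^ 2 ≤ E := by
  haveI : MeasurableSingletonClass (Torus.energySpace (Fin 3)) := OpensMeasurableSpace.toMeasurableSingletonClass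
  have hμ := Torus.isStationaryStatisticalSolution_dirac_holds hν.le hf (by simp) hV hu
  have := h _ hμ (Torus.integrable_dirac u _)
  unfold Torus.ensembleEnergy at this
  rwa [integral_dirac] at this

end Summit.AnomalousDissipation.AnomalousDissipation.Theorems.EnsembleCeiling.Negative
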